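import Summits.MatrixMultiplication.OmegaCensus.SmallFormats.MatMul22nRankGF5XCapParityChecks3
import HarnessLib

/-!
# ω-census family (a): the rectangle-parity lemma for LP-tight points of the X-cap system over `𝔽₅`

Cell `pub-omega` (unit `pub-omega-tensor-g11`), topic `Summits/MatrixMultiplication/OmegaCensus` (sub-folder `SmallFormats`).
Framing (verbatim): lottery ticket; floor = certified bounds/negative ranges. HONEST FRAMING: a structure theorem about the census
INSTRUMENT (the slack-`s` X-cap counting system `xcapSys5s s`, `MatMul22nRankGF5XCapSlack`), not a bound on a rank and not progress on `ω`.

THE LEMMA. Index the 36 rank-one classes by cells `(x, w) ∈ P¹(𝔽₅)²` (`μ(w,x) = [w·(x^⊥)ᵀ]`; the four tangent rows of a cell are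
`z + m(K_{x,w,d}) + μ(w,x) ≤ s`, `K_{x,w,d}` the four derivative classes of `{g : g·x = w} ⊂ PGL₂(5)`). If a nonnegative integer point `x` of
`xcapSys5s s` has total `∑ x ≥ 28 s` (the LP value `s(q²+3)`), then (`tight5_of_total_ge`) `z = 0` and every tangent row is tight, and
(`parityOK5_of_total_ge`) for every rectangle `{x,x′} × {w,w′}` of cells the sum `μ(w,x) + μ(w′,x) + μ(w,x′) + μ(w′,x′)` is EVEN —
equivalently `μ ≡ s + α_x + β_w (mod 2)`. Reason (tensor-g11 structure note): the even (`PSL₂(5)`) and odd halves of `m` are integer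
"designs" with the same cell matrix `2C`, and the two `ℤ`-lattices of such matrices differ (index `2⁸` each in the margin lattice, `2¹⁶`
jointly); the kernel proof is by explicit integer identities: for rectangle `i`, tangent-row multipliers `cp5 i − cm5 i` combine the rows
into `2·ψ + (the four μ's) + 4z` column by column (`parId5_c*` in `MatMul22nRankGF5XCapParityChecks{,2,3}`, `decide`), and tight rows all equal `s`.
USE: discharges the side hypothesis `BoxCert.ParityData.OK` (with the table `⟨225, rq5⟩`) of the parity-leaf certificate checker
(`BoxCertificateParity`) in the slack-4 replay.
-/

namespace Summit.MatrixMultiplication.OmegaCensus.SmallFormats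

open Finset

/-! ## Decide-checked facts about the data -/

set_option maxRecDepth 100000 in
set_option maxHeartbeats 4000000 in
/-- Column sums of the tightness weights: every class lies on `6` weighted rows, the zero form on `156`. -/
theorem yA_ywt5 : ∀ j : Fin 157, xcapSys5.yA ywt5 j.val = if j.val < 156 then 6 else 156 := by decide +kernel

/-- The weighted right-hand sides add up to `168 = 6 · 28` (per unit of slack). -/
theorem sum_ywt5_base : ∑ r ∈ range 498, (ywt5 r : ℤ) * (if r < 344 then 1 else if r < 350 then 2 else 0) = 168 := by decide +kernel

/-- All column identities. -/
theorem parId5_all {i j : ℕ} (hi : i < 225) (hj : j < 157) : parId5 i j := by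
  by_cases h0 : i < 15
  · exact parId5_c0 ⟨i, hi⟩ h0 ⟨j, hj⟩
  by_cases h1 : i < 30
  · exact parId5_c1 ⟨i, hi⟩ (by simp; omega) h1 ⟨j, hj⟩
  by_cases h2 : i < 45
  · exact parId5_c2 ⟨i, hi⟩ (by simp; omega) h2 ⟨j, hj⟩
  by_cases h3 : i < 60
  · exact parId5_c3 ⟨i, hi⟩ (by simp; omega) h3 ⟨j, hj⟩
  by_cases h4 : i < 75
  · exact parId5_c4 ⟨i, hi⟩ (by simp; omega) h4 ⟨j, hj⟩
  by_cases h5 : i < 90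
  · exact parId5_c5 ⟨i, hi⟩ (by simp; omega) h5 ⟨j, hj⟩
  by_cases h6 : i < 105
  · exact parId5_c6 ⟨i, hi⟩ (by simp; omega) h6 ⟨j, hj⟩
  by_cases h7 : i < 120
  · exact parId5_c7 ⟨i, hi⟩ (by simp; omega) h7 ⟨j, hj⟩
  by_cases h8 : i < 135
  · exact parId5_c8 ⟨i, hi⟩ (by simp; omega) h8 ⟨j, hj⟩
  by_cases h9 : i < 150
  · exact parId5_c9 ⟨i, hi⟩ (by simp; omega) h9 ⟨j, hj⟩
  by_cases h10 : i < 165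
  · exact parId5_c10 ⟨i, hi⟩ (by simp; omega) h10 ⟨j, hj⟩
  by_cases h11 : i < 180
  · exact parId5_c11 ⟨i, hi⟩ (by simp; omega) h11 ⟨j, hj⟩
  by_cases h12 : i < 195
  · exact parId5_c12 ⟨i, hi⟩ (by simp; omega) h12 ⟨j, hj⟩
  by_cases h13 : i < 210
  · exact parId5_c13 ⟨i, hi⟩ (by simp; omega) h13 ⟨j, hj⟩
  exact parId5_c14 ⟨i, hi⟩ (by simp; omega) ⟨j, hj⟩

set_option maxRecDepth 100000 in
set_option maxHeartbeats 4000000 in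
/-- Net multiplier mass of every rectangle identity is `4` (the four cell rows; the equidistribution pairs cancel). -/
theorem sum_cp5_sub_cm5 : ∀ i : Fin 225, ∑ r ∈ range 144, ((cp5 i.val r : ℤ) - cm5 i.val r) = 4 := by decide +kernel

set_option maxRecDepth 100000 in
/-- The four classes of a rectangle are class indices `< 156`. -/
theorem rqv5_lt : ∀ i : Fin 225, ∀ k : Fin 4, rqv5 i.val k.val < 156 := by decide +kernel

/-! ## Row sums and the weighted-row identity -/

variable {s : ℕ}

/-- Row `r` of the slack-`s` system evaluated at `x`. -/
def rowVal5 (s : ℕ) (x : ℕ → ℕ) (r : ℕ) : ℤ := ∑ j ∈ range 157, (xcapSys5s s).A r j * (x j : ℤ)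

/-- Weighted rows regroup by columns: `∑_r y_r · row_r(x) = ∑_j (yᵀA)_j · x_j`. -/
theorem sum_mul_rowVal5 (y : ℕ → ℕ) (x : ℕ → ℕ) :
    ∑ r ∈ range 498, (y r : ℤ) * rowVal5 s x r = ∑ j ∈ range 157, xcapSys5.yA y j * (x j : ℤ) := by
  have hy : ∀ j ∈ range 157, xcapSys5.yA y j * (x j : ℤ) = ∑ r ∈ range 498, (y r : ℤ) * ((xcapSys5s s).A r j * (x j : ℤ)) := by
    intro j _
    have e := (xcapSys5s s).yA_eq_sum (xcapSys5s_colWF s) y j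
    change xcapSys5.yA y j = ∑ r ∈ range 498, (y r : ℤ) * (xcapSys5s s).A r j at e
    rw [e, sum_mul]
    exact sum_congr rfl fun r _ => by ring
  rw [sum_congr rfl hy, sum_comm]
  refine sum_congr rfl fun r _ => ?_
  rw [rowVal5, mul_sum]

/-- Feasibility for the full system bounds the 350 cap / row-plane rows (the WLOG rows `350 … 497` are not needed below). -/
theorem rows350_of_feasible {x : ℕ → ℕ} (hfeas : (xcapSys5s s).Feasible x) : ∀ r < 350, rowVal5 s x r ≤ rhs5s s r :=
  fun r hr => hfeas r (by change r < 498; omega)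

/-! ## Tightness -/

/-- **Tightness.** A feasible point of total `≥ 28 s` has no zero forms and every tangent row exactly at its cap `s`. -/
theorem tight5_of_total_ge {x : ℕ → ℕ} (h350 : ∀ r < 350, rowVal5 s x r ≤ rhs5s s r)
    (htot : 28 * (s : ℤ) ≤ ∑ j ∈ range 157, (x j : ℤ)) :
    x 156 = 0 ∧ ∀ r < 144, rowVal5 s x r = s := by
  have ywt5_zero : ∀ r, 350 ≤ r → (ywt5 r : ℤ) = 0 := fun r hr => by
    simp [ywt5, show ¬ r < 144 by omega, show ¬ (344 ≤ r ∧ r < 350) by omega]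
  -- the weighted total
  have hL : ∑ r ∈ range 498, (ywt5 r : ℤ) * rowVal5 s x r = 6 * ∑ j ∈ range 156, (x j : ℤ) + 156 * (x 156 : ℤ) := by
    rw [sum_mul_rowVal5]
    rw [show ∑ j ∈ range 157, xcapSys5.yA ywt5 j * (x j : ℤ) = ∑ j ∈ range 156, xcapSys5.yA ywt5 j * (x j : ℤ)
        + xcapSys5.yA ywt5 156 * (x 156 : ℤ) from by simpa using (sum_range_succ (fun j => xcapSys5.yA ywt5 j * (x j : ℤ)) 156)]
    have h1 : ∀ j ∈ range 156, xcapSys5.yA ywt5 j * (x j : ℤ) = 6 * (x j : ℤ) := by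
      intro j hj
      have := yA_ywt5 ⟨j, by simp at hj; omega⟩
      simp only [show j < 156 from by simpa using hj, if_true] at this
      rw [this]
    have h2 : xcapSys5.yA ywt5 156 = 156 := by
      have := yA_ywt5 ⟨156, by norm_num⟩; simpa using this
    rw [sum_congr rfl h1, h2, ← mul_sum]
  -- its cap
  have hQ : ∑ r ∈ range 498, (ywt5 r : ℤ) * rhs5s s r = 168 * (s : ℤ) := by
    have e : ∀ r ∈ range 498, (ywt5 r : ℤ) * rhs5s s r
        = (s : ℤ) * ((ywt5 r : ℤ) * (if r < 344 then 1 else if r < 350 then 2 else 0)) := by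
      intro r _
      unfold rhs5s; split_ifs <;> ring
    rw [sum_congr rfl e, ← mul_sum, sum_ywt5_base]; ring
  have hle : ∀ r ∈ range 498, (ywt5 r : ℤ) * rowVal5 s x r ≤ (ywt5 r : ℤ) * rhs5s s r := fun r _ => by
    by_cases h : r < 350
    · exact mul_le_mul_of_nonneg_left (h350 r h) (by exact_mod_cast Nat.zero_le _)
    · rw [ywt5_zero r (by omega)]; simp
  have hLQ : ∑ r ∈ range 498, (ywt5 r : ℤ) * rowVal5 s x r ≤ 168 * (s : ℤ) := hQ ▸ sum_le_sum hle
  have hsplit : ∑ j ∈ range 157, (x j : ℤ) = ∑ j ∈ range 156, (x j : ℤ) + (x 156 : ℤ) := by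
    simpa using (sum_range_succ (fun j => (x j : ℤ)) 156)
  have htot' : 28 * (s : ℤ) ≤ ∑ j ∈ range 156, (x j : ℤ) + (x 156 : ℤ) := hsplit ▸ htot
  have hz : x 156 = 0 := by
    have : (x 156 : ℤ) ≤ 0 := by nlinarith [hL, hLQ, htot']
    omega
  refine ⟨hz, ?_⟩
  -- equality everywhere, hence every weighted row is tight
  have hzero : ∑ r ∈ range 498, (ywt5 r : ℤ) * (rhs5s s r - rowVal5 s x r) = 0 := by
    have e : ∑ r ∈ range 498, (ywt5 r : ℤ) * (rhs5s s r - rowVal5 s x r)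
        = ∑ r ∈ range 498, (ywt5 r : ℤ) * rhs5s s r - ∑ r ∈ range 498, (ywt5 r : ℤ) * rowVal5 s x r := by
      rw [← sum_sub_distrib]; exact sum_congr rfl fun r _ => by ring
    rw [e, hQ, hL, hz]; push_cast
    nlinarith [hL, hLQ, htot', hz]
  have hnn : ∀ r ∈ range 498, 0 ≤ (ywt5 r : ℤ) * (rhs5s s r - rowVal5 s x r) := fun r _ => by
    by_cases h : r < 350
    · exact mul_nonneg (by exact_mod_cast Nat.zero_le _) (sub_nonneg.2 (h350 r h))
    · rw [ywt5_zero r (by omega)]; simp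
  have hterm := (sum_eq_zero_iff_of_nonneg hnn).1 hzero
  intro r hr
  have h := hterm r (mem_range.2 (by omega))
  have hw : (ywt5 r : ℤ) = 1 := by simp [ywt5, hr]
  have hrhs : rhs5s s r = s := by simp [rhs5s, show r < 344 by omega]
  rw [hw, one_mul, sub_eq_zero, hrhs] at h
  exact h.symm

/-! ## Parity -/

/-- **Rectangle parity.** A feasible point of total `≥ 28 s` has an even sum of the four rank-one classes of every rectangle of cells. -/
theorem parityOK5_of_total_ge {x : ℕ → ℕ} (h350 : ∀ r < 350, rowVal5 s x r ≤ rhs5s s r)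
    (htot : 28 * (s : ℤ) ≤ ∑ j ∈ range 157, (x j : ℤ)) :
    ∀ i < 225, Even (x (rqv5 i 0) + x (rqv5 i 1) + x (rqv5 i 2) + x (rqv5 i 3)) := by
  obtain ⟨hz, htight⟩ := tight5_of_total_ge h350 htot
  intro i hi
  -- combine the rows with the multipliers cp − cm
  have hcols : ∑ r ∈ range 498, ((cp5 i r : ℤ) - cm5 i r) * rowVal5 s x r
      = ∑ j ∈ range 157, (xcapSys5.yA (cp5 i) j - xcapSys5.yA (cm5 i) j) * (x j : ℤ) := by
    have e1 := sum_mul_rowVal5 (s := s) (cp5 i) x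
    have e2 := sum_mul_rowVal5 (s := s) (cm5 i) x
    have : ∑ r ∈ range 498, ((cp5 i r : ℤ) - cm5 i r) * rowVal5 s x r
        = ∑ r ∈ range 498, (cp5 i r : ℤ) * rowVal5 s x r - ∑ r ∈ range 498, (cm5 i r : ℤ) * rowVal5 s x r := by
      rw [← sum_sub_distrib]; exact sum_congr rfl fun r _ => by ring
    rw [this, e1, e2, ← sum_sub_distrib]
    exact sum_congr rfl fun j _ => by ring
  -- left side: the multipliers live on tangent rows, all tight
  have hleft : ∑ r ∈ range 498, ((cp5 i r : ℤ) - cm5 i r) * rowVal5 s x r = 4 * (s : ℤ) := by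
    have e : ∀ r ∈ range 498, ((cp5 i r : ℤ) - cm5 i r) * rowVal5 s x r = ((cp5 i r : ℤ) - cm5 i r) * (s : ℤ) := by
      intro r _
      by_cases hr : r < 144
      · rw [htight r hr]
      · simp [cp5, cm5, hr]
    have hvan : ∑ r ∈ Ico 144 498, ((cp5 i r : ℤ) - cm5 i r) * (s : ℤ) = 0 :=
      sum_eq_zero fun r hr => by
        have hr' : ¬ r < 144 := by simp at hr; omega
        simp [cp5, cm5, hr']
    rw [sum_congr rfl e, ← sum_range_add_sum_Ico _ (show 144 ≤ 498 by norm_num), hvan, add_zero, ← sum_mul,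
      sum_cp5_sub_cm5 ⟨i, hi⟩]
  -- right side: the column identities
  have hright : ∑ j ∈ range 157, (xcapSys5.yA (cp5 i) j - xcapSys5.yA (cm5 i) j) * (x j : ℤ)
      = 2 * ∑ j ∈ range 157, ps5 i j * (x j : ℤ) + (x (rqv5 i 0) : ℤ) + x (rqv5 i 1) + x (rqv5 i 2) + x (rqv5 i 3)
        + 4 * (x 156 : ℤ) := by
    have e : ∀ j ∈ range 157, (xcapSys5.yA (cp5 i) j - xcapSys5.yA (cm5 i) j) * (x j : ℤ)
        = 2 * (ps5 i j * (x j : ℤ)) + (if j = rqv5 i 0 then (x j : ℤ) else 0) + (if j = rqv5 i 1 then (x j : ℤ) else 0)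
          + (if j = rqv5 i 2 then (x j : ℤ) else 0) + (if j = rqv5 i 3 then (x j : ℤ) else 0)
          + (if j = 156 then 4 * (x j : ℤ) else 0) := by
      intro j hj
      have hid : parId5 i j := parId5_all hi (mem_range.1 hj)
      unfold parId5 at hid
      rw [hid]; split_ifs <;> ring
    rw [sum_congr rfl e, sum_add_distrib, sum_add_distrib, sum_add_distrib, sum_add_distrib, sum_add_distrib, ← mul_sum,
      sum_ite_eq' (range 157), sum_ite_eq' (range 157), sum_ite_eq' (range 157), sum_ite_eq' (range 157), sum_ite_eq' (range 157)]
    have m0 : rqv5 i 0 ∈ range 157 := mem_range.2 (by have := rqv5_lt ⟨i, hi⟩ 0; simp at this; omega)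
    have m1 : rqv5 i 1 ∈ range 157 := mem_range.2 (by have := rqv5_lt ⟨i, hi⟩ 1; simp at this; omega)
    have m2 : rqv5 i 2 ∈ range 157 := mem_range.2 (by have := rqv5_lt ⟨i, hi⟩ 2; simp at this; omega)
    have m3 : rqv5 i 3 ∈ range 157 := mem_range.2 (by have := rqv5_lt ⟨i, hi⟩ 3; simp at this; omega)
    rw [if_pos m0, if_pos m1, if_pos m2, if_pos m3, if_pos (mem_range.2 (by norm_num))]
  have key : ((x (rqv5 i 0) + x (rqv5 i 1) + x (rqv5 i 2) + x (rqv5 i 3) : ℕ) : ℤ)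
      = 2 * (2 * (s : ℤ) - ∑ j ∈ range 157, ps5 i j * (x j : ℤ)) := by
    push_cast
    have := hleft; rw [hcols, hright, hz] at this; push_cast at this
    linarith
  have hev : Even (((x (rqv5 i 0) + x (rqv5 i 1) + x (rqv5 i 2) + x (rqv5 i 3) : ℕ) : ℤ)) :=
    ⟨2 * (s : ℤ) - ∑ j ∈ range 157, ps5 i j * (x j : ℤ), by rw [key]; ring⟩
  exact (Int.even_coe_nat _).1 hev

/-- Tightness for feasible points of the full (WLOG-rowed) system `xcapSys5s s`. -/
theorem tight5_of_feasible {x : ℕ → ℕ} (hfeas : (xcapSys5s s).Feasible x) (htot : 28 * (s : ℤ) ≤ ∑ j ∈ range 157, (x j : ℤ)) :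
    x 156 = 0 ∧ ∀ r < 144, rowVal5 s x r = s :=
  tight5_of_total_ge (rows350_of_feasible hfeas) htot

/-- **Rectangle parity** for feasible points of the full (WLOG-rowed) system `xcapSys5s s` of total `≥ 28 s`. -/
theorem parityOK5_of_feasible {x : ℕ → ℕ} (hfeas : (xcapSys5s s).Feasible x) (htot : 28 * (s : ℤ) ≤ ∑ j ∈ range 157, (x j : ℤ)) :
    ∀ i < 225, Even (x (rqv5 i 0) + x (rqv5 i 1) + x (rqv5 i 2) + x (rqv5 i 3)) :=
  parityOK5_of_total_ge (rows350_of_feasible hfeas) htot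

end Summit.MatrixMultiplication.OmegaCensus.SmallFormats
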